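import Literature.NumberTheory.ComplexMultiplication.TateHalfTransferReflexNorm
import Literature.NumberTheory.ComplexMultiplication.TaniyamaElement
import Literature.NumberTheory.ComplexMultiplication.ReflexNormArtinMapCyclotomic
import HarnessLib

/-!
# Milne 2007, PROPOSITION 4.9: `N_Φ(a) ∈ f_Φ(σ)` — the Taniyama element on `Aut(ℂ/E*)` is the reflex norm
# (Milne, *The fundamental theorem of complex multiplication*, arXiv:0705.3446, §4.2)

Topic `NumberTheory/ComplexMultiplication`; namespace `Literature.NumberTheory.ComplexMultiplication`.  Lane
`lit-hodgefound` (Track 2, Layer A3 skeleton seat `skel-3`, row A3-G46 FILE 5 of 5 — the junction of row A3-G45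
(`…/TaniyamaElement`: Tate's `f_Ψ(σ) ∈ 𝔸^×_{E,f}/E^×`, Prop. 4.6, 4.8 (a), (c)) with row A3-G39 (`…/ReflexNormArtinMap`:
`reflexNormFiniteClassOfGalois`, `[σ] ↦ N_{k,Φ}(s)_𝐡 · E^×`), through FILE 4 `…/TateHalfTransferReflexNorm`
(`art_E(N_Φ(a)) = F_Φ(σ)`) and row A3-G40's rider `…/ReflexNormArtinMapCyclotomic` (`N_Φ(a)·ιN_Φ(a) ∈ χ_cyc(σ)E^×`)).
THEOREMS ONLY, all proved; no definition, no named fact, no instance (D-0026, net debt 0).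

## The print, verbatim

J. S. Milne, *The fundamental theorem of complex multiplication*, arXiv:0705.3446 [Milne2007FundamentalCM], §4.2 (held
`paper:arxiv-0705.3446` p0019 L87–L90, p0020 L52–L66 and L112–L115; the cross-references are to §3, Lemma 3.7 = p0015 L132–L140
and Prop. 3.9 = p0016 L24–L26):

> «In (3.9) we saw that `N_Φ` gives a well-defined homomorphism `Aut(ℂ/E*) → 𝔸^×_{f,E}/E^×`. In this subsection, we
> extend this to a homomorphism on the whole of `Aut(ℂ)`. […] The fundamental theorem of complex multiplication over the
> reflex field states the following: let `σ ∈ Aut(ℂ/E*)`, and let `a ∈ 𝔸^×_{f,E*}/E*^×` be such that `art_{E*}(a) = σ`;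
> then (4.2) is true after `f` has been replaced by `N_Φ(a)` (see Theorem 3.10 […]). The next result shows that this is in
> agreement with (4.2).
>
> PROPOSITION 4.9. For any `σ ∈ Aut(ℂ/E*)` and `a ∈ 𝔸^×_{f,E*}/E*^×` such that `art_{E*}(a) = σ|E*^ab`, `N_Φ(a) ∈ f_Φ(σ)`.
>
> PROOF. […] Thus `art_E(N_Φ(a)) = ∏ art_E(b_j) = ∏ F_j(σ) = F_Φ(σ)`. As `N_Φ(a)·ιN_Φ(a) ∈ χ_cyc(σ)E^×` (see (3.7)), this
> shows that `N_Φ(a) ∈ f_Φ(σ)`.»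

## Setting and sign conventions (as in rows A3-G39/G40/G45 and FILE 4)

`K : Type` a CM number field (Milne's `E`), `Φ : CMType K`, `E* = traceField Φ ⊆ k ⊂ ℂ`, `k` a number field (the print is
`k = E*`; `N_{k,Φ} = reflexNormIdele K Φ k = N_Φ ∘ Nm_{k/E*}`); `j : Q̄ → ℂ` an embedding compatible with `k ⊂ ℂ`
(`hj`), `c ∈ Γ_ℚ` a complex conjugation acting as `z ↦ z̄` along `j` (`hc`, `hjc`) — such a pair exists for every `k`
(§3 `exists_embedding_isComplexConjugation`); `Ψ = Θ⁻¹(Φ) ⊆ Γ_ℚ ⧸ Γ_K` the CM type read along `Θ = embOfCoset K j`, and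
`f_Ψ = taniyamaElement K c Ψ : Γ_ℚ → (𝔸_{K,f})ˣ/K^×` Tate's Taniyama element (row A3-G45: the unique class with
`[(1,f), K] = F_Ψ(σ)⁻¹` and `f·ι_K f = χ(σ)K^×`).  The tree's Artin maps are `[·, F] = art_F⁻¹`; hence Milne's hypothesis
«`art_{E*}(a) = σ|E*^ab`» reads **`[a, k] = [σ⁻¹]`**, i.e. `absGaloisAbProj k τ = ideleArtinMap k a` with `τ = σ⁻¹`, and the
conclusion «`N_Φ(a) ∈ f_Φ(σ)`» reads `N_{k,Φ}(a)_𝐡 · K^× = f_Ψ(res σ) = f_Ψ(res τ⁻¹)`.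

## What is proved

* §1 **The two complex conjugations on `𝔸_K` agree**: the place-by-place Galois action of `ι_K ∈ Gal(K/K⁺)`
  (`…Automorphic/GaloisActionAdeleRing`, used by row A3-G45's `finiteIdeleConjGal`) IS `1 ⊗ ι_K` on `𝔸_ℚ ⊗_ℚ K = 𝔸_K`
  (flt-inv's `adeleComplexConj`, used by row A3-G39's `finiteIdeleComplexConj`): both are ring endomorphisms of `𝔸_K`
  fixing `con(𝔸_ℚ)` and acting as `ι_K` on `K` (`complexConj_smul_eq_adeleComplexConj`, `finiteIdeleConjGal_eq_finiteIdeleComplexConj`).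
* §2 **PROPOSITION 4.9** (`mk_finitePart_reflexNormIdele_eq_taniyamaElement`): for `τ ∈ Γ_k` and `s ∈ 𝕀_k` with
  `[s, k] = [τ]`, **`N_{k,Φ}(s)_𝐡 · K^× = f_Ψ(res τ⁻¹)`** — by the uniqueness in Prop. 4.6 (`eq_taniyamaElement`): (a)
  `[(1, N(s)_𝐡), K] = [N(s), K] = F_Ψ(res τ) = F_Ψ(res τ⁻¹)⁻¹` (FILE 4 `ideleArtinMap_reflexNormIdele_eq_tateHalfTransfer`,
  «`art_E(N_Φ(a)) = F_Φ(σ)`») and (b) `N(s)_𝐡 · ι_K N(s)_𝐡 ≡ χ(res τ)⁻¹ = χ(res τ⁻¹)` (A3-G40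
  `finitePart_reflexNormIdele_mul_conj_mul_con_cyclotomicIdele_mem_range`, «`N_Φ(a)·ιN_Φ(a) ∈ χ_cyc(σ)E^×`», with §1 to
  match the two `ι_K`); Milne's literal form with `a`, `σ` (`…_of_ideleArtinMap_eq`); on the Galois side
  **`reflexNormFiniteClassOfGalois [τ] = f_Ψ(res τ⁻¹) = f_Ψ(res τ)⁻¹`** and **`f_Ψ(res τ) = (reflexNormFiniteClassOfGalois [τ])⁻¹`**
  (`taniyamaElement_absGaloisRestrict`) — «`f_Φ` extends the homomorphism `N_Φ : Aut(ℂ/E*) → 𝔸^×_{f,E}/E^×`».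
* §3 **Existence of the data `(j, c)` for a given `k ⊂ ℂ`** (`exists_embedding_isComplexConjugation`: extend `k ⊂ ℂ` to
  `k̄ → ℂ`, transport to `Q̄`, and take for `c` the automorphism by which `\overline{j}` differs from `j`), and the
  packaged statement `exists_taniyamaElement_absGaloisRestrict_eq`.

NOT HERE: Theorems 4.1/4.2 (abelian varieties; Layer B); Prop. 4.8 (b); Milne's `Aut(ℂ)`-parametrisation (`σ ∈ Γ_ℚ` here).

## References

* J. S. Milne, *The fundamental theorem of complex multiplication*, arXiv:0705.3446 (2007), §4.2 Prop. 4.9, Prop. 4.6;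
  §3 Lemma 3.7, Prop. 3.9. [Milne2007FundamentalCM]
* J. S. Milne, *Complex Multiplication* (course notes), Ch. II §9, Lemma 9.7, Theorem 9.10 / Remark 9.11 (a). [MilneCM2006]
* J. W. S. Cassels, A. Fröhlich (eds.), *Algebraic Number Theory* (1967), Ch. II §14 (14.2), Ch. VII §1.1. [CasselsFrohlichANT1967]

## Provenance

Lane `lit-hodgefound`, seat `literature-prover-lit-hodgefound-skel-3-g30-0` (row A3-G46, FILE 5 of 5).
-/

set_option autoImplicit false

noncomputable section

open scoped Pointwise TensorProduct

namespace Literature.NumberTheory.ComplexMultiplication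

open Field NumberField IsDedekindDomain
open Literature.NumberTheory.GaloisRepresentations Literature.NumberTheory.NumberFields
open Literature.NumberTheory.AdelicBaseChange
open Literature.AlgebraicGeometry.Motives (CMType)
open HalfTransfer

/-! ### §1. The Galois action of `ι_K` on `𝔸_K` is `1 ⊗ ι_K` -/

section Bridge

variable (K : Type) [Field K] [NumberField K] [IsCMField K]

/-- `ι_K` fixes `con(𝔸_ℚ) ⊆ 𝔸_K` (`con_{K/ℚ} = con_{K/K⁺} ∘ con_{K⁺/ℚ}` and `Gal(K/K⁺)` fixes `𝔸_{K⁺}`).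
[cite: CasselsFrohlichANT1967, Ch. II §19 (19.3), Ch. VII §1.1] -/
theorem complexConj_smul_baseChange_rat (r : AdeleRing (𝓞 ℚ) ℚ) :
    IsCMField.complexConj K • NumberField.AdeleRing.baseChange ℚ K r = NumberField.AdeleRing.baseChange ℚ K r := by
  rw [← adeleRing_baseChange_baseChange ℚ (maximalRealSubfield K) K, adeleRing_baseChange_apply_eq (maximalRealSubfield K) K,
    Literature.NumberTheory.Automorphic.AdeleRing.smul_baseChange]

/-- **The place-by-place action of `ι_K ∈ Gal(K/K⁺)` on `𝔸_K` is `1 ⊗ ι_K` on `𝔸_ℚ ⊗_ℚ K = 𝔸_K`** (flt-inv's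
`adeleComplexConj`): both are ring endomorphisms, and they agree on the generators `(a)·con(r)`, `a ∈ K`, `r ∈ 𝔸_ℚ`.
[cite: CasselsFrohlichANT1967, Ch. II §14 Lemma (14.2), Ch. VII §1.1] [cite: MilneCM2006, Ch. I §1 Rem. 1.24 (b) (10)] -/
theorem complexConj_smul_eq_adeleComplexConj (x : AdeleRing (𝓞 K) K) :
    IsCMField.complexConj K • x = adeleComplexConj K x := by
  obtain ⟨z, rfl⟩ := (ratAdeleTensorEquiv K).surjective x
  induction z using TensorProduct.induction_on with
  | zero => rw [map_zero, map_zero, smul_zero]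
  | tmul r a =>
    rw [adeleComplexConj_ratAdeleTensorEquiv, conjPoints_tmul, ratAdeleTensorEquiv_tmul, ratAdeleTensorEquiv_tmul,
      smul_mul', Literature.NumberTheory.Automorphic.AdeleRing.smul_algebraMap, complexConj_smul_baseChange_rat]
  | add x y hx hy => rw [map_add, map_add, smul_add, hx, hy]

/-- The same on FINITE adèles: `ι_K • y = finiteAdeleComplexConj K y`. [cite: CasselsFrohlichANT1967, Ch. II §14 Lemma (14.2), Ch. VII §1.1] -/
theorem complexConj_smul_eq_finiteAdeleComplexConj (y : FiniteAdeleRing (𝓞 K) K) :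
    IsCMField.complexConj K • y = finiteAdeleComplexConj K y := by
  rw [finiteAdeleComplexConj_eq_snd, ← complexConj_smul_eq_adeleComplexConj,
    Literature.NumberTheory.Automorphic.AdeleRing.smul_snd]

/-- **Row A3-G45's `ι_K` on finite idèles (`finiteIdeleConjGal`) IS row A3-G39's (`finiteIdeleComplexConj`).**
[cite: Milne2007FundamentalCM, §4.2 Prop. 4.6 (b) («ι f_Φ(σ)»)] [cite: MilneCM2006, Ch. II §9, Lemma 9.7 («ι_E N_Φ(s)»)] -/
theorem finiteIdeleConjGal_eq_finiteIdeleComplexConj (y : (FiniteAdeleRing (𝓞 K) K)ˣ) :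
    finiteIdeleConjGal K y = finiteIdeleComplexConj K y :=
  Units.ext (complexConj_smul_eq_finiteAdeleComplexConj K (y : FiniteAdeleRing (𝓞 K) K))

/-- On classes: `ι_K (y·K^×) = (finiteIdeleComplexConj K y)·K^×`. [cite: Milne2007FundamentalCM, §4.2 Prop. 4.6 (b)] -/
theorem finiteClassConjGal_mk_eq (y : (FiniteAdeleRing (𝓞 K) K)ˣ) :
    finiteClassConjGal K (QuotientGroup.mk y) = QuotientGroup.mk (finiteIdeleComplexConj K y) := by
  rw [finiteClassConjGal_mk, finiteIdeleConjGal_eq_finiteIdeleComplexConj]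

end Bridge

/-! ### §2. Proposition 4.9 -/

section Prop49

variable (K : Type) [Field K] [NumberField K] [IsCMField K] (Φ : CMType K) (k : IntermediateField ℚ ℂ) [NumberField k]

/-- **(b) for `N_{k,Φ}(s)_𝐡` at `res τ⁻¹`: `N(s)_𝐡 · ι_K N(s)_𝐡 · K^× = χ(res τ⁻¹)·K^×`** whenever `[s, k] = [τ]` — «As
`N_Φ(a)·ιN_Φ(a) ∈ χ_cyc(σ)E^×` (see (3.7))» (row A3-G40 `finitePart_reflexNormIdele_mul_conj_mul_con_cyclotomicIdele_mem_range`,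
with §1 to identify the two `ι_K`). [cite: Milne2007FundamentalCM, §4.2 Prop. 4.9 (proof, last sentence)] [cite: MilneCM2006, Ch. II §9, Lemma 9.7] -/
theorem mk_finitePart_reflexNormIdele_mul_finiteClassConjGal (hk : traceField Φ ≤ k) {τ : absoluteGaloisGroup k}
    {s : ideleGroup k} (hs : absGaloisAbProj k τ = ideleArtinMap k s) :
    (QuotientGroup.mk (IdeleAction.finitePart K (reflexNormIdele K Φ k s)) :
          (FiniteAdeleRing (𝓞 K) K)ˣ ⧸ (FiniteAdeleRing.unitEmbedding (𝓞 K) K).range) *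
        finiteClassConjGal K (QuotientGroup.mk (IdeleAction.finitePart K (reflexNormIdele K Φ k s))) =
      QuotientGroup.mk (cyclotomicFiniteIdeleIn K (absGaloisRestrict ℚ k τ⁻¹)) := by
  rw [finiteClassConjGal_mk_eq, ← QuotientGroup.mk_mul, map_inv, map_inv, QuotientGroup.eq, ← mul_inv, inv_mem_iff,
    cyclotomicFiniteIdeleIn_apply]
  exact finitePart_reflexNormIdele_mul_conj_mul_con_cyclotomicIdele_mem_range K Φ k hk hs

variable {j : AlgebraicClosure ℚ →+* ℂ} (hj : ∀ x : k, j (absEmbedding ℚ k x) = (x : ℂ))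
  {υ : ℚ →+* ℝ} {c : absoluteGaloisGroup ℚ} (hc : IsComplexConjugation υ c)
  (hjc : ∀ y : AlgebraicClosure ℚ, j (c • y) = starRingEnd ℂ (j y))

include hj hc hjc

/-- **(a) for `N_{k,Φ}(s)_𝐡` at `res τ⁻¹`: `[(1, N(s)_𝐡), K] = F_Ψ(res τ⁻¹)⁻¹`** whenever `[s, k] = [τ]` — «Thus
`art_E(N_Φ(a)) = F_Φ(σ)`» (FILE 4 `ideleArtinMap_reflexNormIdele_eq_tateHalfTransfer`; `[(1, x_𝐡), K] = [x, K]` for `K`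
totally complex; `F_Ψ(res τ⁻¹) = F_Ψ(res τ)⁻¹`). [cite: Milne2007FundamentalCM, §4.2 Prop. 4.9 (proof: «art_E(N_Φ(a)) = … = F_Φ(σ)»)] -/
theorem finiteClassArtinMap_mk_finitePart_reflexNormIdele (hk : traceField Φ ≤ k) {τ : absoluteGaloisGroup k}
    {s : ideleGroup k} (hs : absGaloisAbProj k τ = ideleArtinMap k s) :
    finiteClassArtinMap K (QuotientGroup.mk (IdeleAction.finitePart K (reflexNormIdele K Φ k s))) =
      (tateHalfTransfer K c (embOfCoset K j ⁻¹' Φ.1) (absGaloisRestrict ℚ k τ⁻¹))⁻¹ := by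
  rw [finiteClassArtinMap_mk, FiniteIdeleClosure.ideleArtinMap_units_map_inr_finitePart,
    ideleArtinMap_reflexNormIdele_eq_tateHalfTransfer K Φ k hj hc hjc hk hs,
    tateHalfTransfer_absGaloisRestrict_inv K Φ k hj hc hjc hk τ, inv_inv]

/-- **PROPOSITION 4.9 (Milne 2007): `N_{k,Φ}(s)_𝐡 · K^× = f_Ψ(res τ⁻¹)` for all `τ ∈ Γ_k`, `s ∈ 𝕀_k` with `[s, k] = [τ]`**
(`k ⊇ E*`; Milne's `σ = τ⁻¹`, `a = s`: «for any `σ ∈ Aut(ℂ/E*)` and `a` such that `art_{E*}(a) = σ|E*^ab`, `N_Φ(a) ∈ f_Φ(σ)`»).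
PROOF as printed: `N(s)_𝐡 · K^×` satisfies the two conditions (a) `art_E = F_Φ(σ)` and (b) `f·ιf = χ(σ)E^×` that determine
`f_Φ(σ)` (Prop. 4.6, row A3-G45 `eq_taniyamaElement`). [cite: Milne2007FundamentalCM, §4.2 Prop. 4.9] -/
theorem mk_finitePart_reflexNormIdele_eq_taniyamaElement (hk : traceField Φ ≤ k) {τ : absoluteGaloisGroup k}
    {s : ideleGroup k} (hs : absGaloisAbProj k τ = ideleArtinMap k s) :
    (QuotientGroup.mk (IdeleAction.finitePart K (reflexNormIdele K Φ k s)) :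
        (FiniteAdeleRing (𝓞 K) K)ˣ ⧸ (FiniteAdeleRing.unitEmbedding (𝓞 K) K).range) =
      taniyamaElement K c (embOfCoset K j ⁻¹' Φ.1) (absGaloisRestrict ℚ k τ⁻¹) :=
  eq_taniyamaElement hc (isCMTypeWith_preimage_cmType K hc hjc Φ)
    (finiteClassArtinMap_mk_finitePart_reflexNormIdele K Φ k hj hc hjc hk hs)
    (mk_finitePart_reflexNormIdele_mul_finiteClassConjGal K Φ k hk hs)

/-- **PROPOSITION 4.9 in Milne's letters**: for `σ ∈ Γ_k` and `a ∈ 𝕀_k` with `art_k(a) = σ|k^ab`, i.e. `[a, k] = [σ⁻¹]`,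
**`N_{k,Φ}(a)_𝐡 ∈ f_Ψ(res σ)`** (`N_{k,Φ}(a)_𝐡 · K^× = f_Ψ(res σ)`). [cite: Milne2007FundamentalCM, §4.2 Prop. 4.9] -/
theorem mk_finitePart_reflexNormIdele_eq_taniyamaElement_of_ideleArtinMap_eq (hk : traceField Φ ≤ k)
    {σ : absoluteGaloisGroup k} {a : ideleGroup k} (ha : ideleArtinMap k a = absGaloisAbProj k σ⁻¹) :
    (QuotientGroup.mk (IdeleAction.finitePart K (reflexNormIdele K Φ k a)) :
        (FiniteAdeleRing (𝓞 K) K)ˣ ⧸ (FiniteAdeleRing.unitEmbedding (𝓞 K) K).range) =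
      taniyamaElement K c (embOfCoset K j ⁻¹' Φ.1) (absGaloisRestrict ℚ k σ) := by
  have h := mk_finitePart_reflexNormIdele_eq_taniyamaElement K Φ k hj hc hjc hk ha.symm
  rwa [inv_inv] at h

/-- **On the Galois side: `reflexNormFiniteClassOfGalois [τ] = f_Ψ(res τ⁻¹)`** — row A3-G39's well-defined map
`[s, k] ↦ N_{k,Φ}(s)_𝐡 · K^×` (Milne CM (64) / Remark 9.11 (a)) is Tate's Taniyama element on `Γ_k`, up to the inversion
forced by `[·, k] = art_k⁻¹`. [cite: Milne2007FundamentalCM, §4.2 Prop. 4.9] [cite: MilneCM2006, Ch. II §9, Remark 9.11 (a)] -/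
theorem reflexNormFiniteClassOfGalois_eq_taniyamaElement (hk : traceField Φ ≤ k) (τ : absoluteGaloisGroup k) :
    reflexNormFiniteClassOfGalois K Φ k hk (absGaloisAbProj k τ) =
      taniyamaElement K c (embOfCoset K j ⁻¹' Φ.1) (absGaloisRestrict ℚ k τ⁻¹) := by
  obtain ⟨s, hs⟩ := ideleArtinMap_surjective k (absGaloisAbProj k τ)
  rw [← hs, reflexNormFiniteClassOfGalois_ideleArtinMap]
  exact mk_finitePart_reflexNormIdele_eq_taniyamaElement K Φ k hj hc hjc hk hs.symm

/-- `f_Ψ(res τ⁻¹) = f_Ψ(res τ)⁻¹`: `f_Ψ ∘ res` is a homomorphism on `Γ_k` (`Γ_k` stabilises `Ψ`, FILE 4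
`absGaloisRestrict_smul_preimage_cmType`; Prop. 4.8 (a)). [cite: Milne2007FundamentalCM, §4.2 Prop. 4.8 (a), Prop. 4.9] -/
theorem taniyamaElement_absGaloisRestrict_inv (hk : traceField Φ ≤ k) (τ : absoluteGaloisGroup k) :
    taniyamaElement K c (embOfCoset K j ⁻¹' Φ.1) (absGaloisRestrict ℚ k τ⁻¹) =
      (taniyamaElement K c (embOfCoset K j ⁻¹' Φ.1) (absGaloisRestrict ℚ k τ))⁻¹ := by
  have hΨ : IsCMTypeWith c (embOfCoset K j ⁻¹' Φ.1) := isCMTypeWith_preimage_cmType K hc hjc Φ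
  refine eq_inv_of_mul_eq_one_left ?_
  rw [← taniyamaElement_mul_of_smul_eq hc hΨ _ (absGaloisRestrict_smul_preimage_cmType k hj K Φ hk τ), ← map_mul,
    inv_mul_cancel, map_one, taniyamaElement_one hc hΨ]

/-- **`f_Ψ(res τ) = (reflexNormFiniteClassOfGalois [τ])⁻¹` for every `τ ∈ Γ_k`: Tate's Taniyama element EXTENDS the reflex-norm
homomorphism `N_Φ : Aut(ℂ/E*) → 𝔸^×_{f,E}/E^×`** («In (3.9) we saw that `N_Φ` gives a well-defined homomorphism
`Aut(ℂ/E*) → 𝔸^×_{f,E}/E^×`. In this subsection, we extend this to […] the whole of `Aut(ℂ)`» + Prop. 4.9; the inversion is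
the tree's `[·, k] = art_k⁻¹`). [cite: Milne2007FundamentalCM, §4.2 (introduction) and Prop. 4.9] -/
theorem taniyamaElement_absGaloisRestrict (hk : traceField Φ ≤ k) (τ : absoluteGaloisGroup k) :
    taniyamaElement K c (embOfCoset K j ⁻¹' Φ.1) (absGaloisRestrict ℚ k τ) =
      (reflexNormFiniteClassOfGalois K Φ k hk (absGaloisAbProj k τ))⁻¹ := by
  rw [reflexNormFiniteClassOfGalois_eq_taniyamaElement K Φ k hj hc hjc hk τ,
    taniyamaElement_absGaloisRestrict_inv K Φ k hj hc hjc hk τ]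
  exact (inv_inv (taniyamaElement K c (embOfCoset K j ⁻¹' Φ.1) (absGaloisRestrict ℚ k τ))).symm

/-- **`f_Ψ ∘ res_ℚ^k` is a group homomorphism on `Γ_k`** (it factors through `Γ_k^ab` as `γ ↦ (reflexNormFiniteClassOfGalois γ)⁻¹`;
directly: Prop. 4.8 (a) with `τΨ = Ψ` for `τ ∈ Γ_k`, FILE 4 `absGaloisRestrict_smul_preimage_cmType`).
[cite: Milne2007FundamentalCM, §4.2 (introduction: «a well-defined homomorphism Aut(ℂ/E*) → 𝔸^×_{f,E}/E^×»), Prop. 4.8 (a), Prop. 4.9] -/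
theorem taniyamaElement_absGaloisRestrict_mul (hk : traceField Φ ≤ k) (σ τ : absoluteGaloisGroup k) :
    taniyamaElement K c (embOfCoset K j ⁻¹' Φ.1) (absGaloisRestrict ℚ k (σ * τ)) =
      taniyamaElement K c (embOfCoset K j ⁻¹' Φ.1) (absGaloisRestrict ℚ k σ) *
        taniyamaElement K c (embOfCoset K j ⁻¹' Φ.1) (absGaloisRestrict ℚ k τ) :=
  (congrArg (taniyamaElement K c (embOfCoset K j ⁻¹' Φ.1)) (map_mul (absGaloisRestrict ℚ k) σ τ)).trans
    (taniyamaElement_mul_of_smul_eq hc (isCMTypeWith_preimage_cmType K hc hjc Φ) (absGaloisRestrict ℚ k σ)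
      (absGaloisRestrict_smul_preimage_cmType k hj K Φ hk τ))

end Prop49

/-! ### §3. Existence of an embedding `j : Q̄ → ℂ` over `k ⊂ ℂ` and of a complex conjugation `c` along it -/

section Existence

/-- Two embeddings `F̄ → ℂ` agreeing on `F` differ by an element of `Γ_F` (Mathlib's
`ComplexEmbedding.exists_comp_symm_eq_of_comp_eq` for the Galois extension `F̄/F`). [cite: MilneFT2022, Ch. 7 (the absolute Galois group)] -/
theorem exists_absoluteGaloisGroup_smul_eq {F : Type} [Field F] [CharZero F] (ι ι' : AlgebraicClosure F →+* ℂ)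
    (h : ι.comp (algebraMap F (AlgebraicClosure F)) = ι'.comp (algebraMap F (AlgebraicClosure F))) :
    ∃ γ : absoluteGaloisGroup F, ∀ y : AlgebraicClosure F, ι (γ • y) = ι' y := by
  obtain ⟨σ, hσ⟩ := ComplexEmbedding.exists_comp_symm_eq_of_comp_eq (k := F) (K := AlgebraicClosure F) ι ι' h
  exact ⟨(absoluteGaloisGroup.toAlgEquiv F).symm σ.symm, fun y => by
    rw [absoluteGaloisGroup.toAlgEquiv_symm_apply]
    exact RingHom.congr_fun hσ y⟩

/-- **For every number field `k ⊂ ℂ` there are an embedding `j : Q̄ → ℂ` inducing `k ⊂ ℂ` on `e(k)` and a complex conjugation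
`c ∈ Γ_ℚ` acting as `z ↦ z̄` along `j`** («Choose an embedding `E ↪ ℂ`, and extend it to an embedding `i : E^ab ↪ ℂ`»; «we can
suppose `E ⊂ ℂ`»): extend `k ⊂ ℂ` to `k̄ → ℂ` (`ℂ` algebraically closed), transport along `Q̄ ≅ k̄`, and let `c` be the
automorphism of `Q̄` by which `\overline{j}` differs from `j`. [cite: Milne2007FundamentalCM, §4.2 (before Lemma 4.4) and Lemma 4.5] -/
theorem exists_embedding_isComplexConjugation (k : IntermediateField ℚ ℂ) [NumberField k] :
    ∃ (j : AlgebraicClosure ℚ →+* ℂ) (c : absoluteGaloisGroup ℚ),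
      (∀ x : k, j (absEmbedding ℚ k x) = (x : ℂ)) ∧ IsComplexConjugation (Rat.castHom ℝ) c ∧
        ∀ y : AlgebraicClosure ℚ, j (c • y) = starRingEnd ℂ (j y) := by
  haveI : Module.IsTorsionFree k (AlgebraicClosure k) := Module.Free.instIsTorsionFree _ _
  haveI : Module.IsTorsionFree k ℂ := Module.Free.instIsTorsionFree _ _
  let ιk : AlgebraicClosure k →ₐ[k] ℂ := IsAlgClosed.lift
  let j : AlgebraicClosure ℚ →+* ℂ := (ιk : AlgebraicClosure k →+* ℂ).comp
    ((absClosureEquiv ℚ k : AlgebraicClosure ℚ ≃ₐ[ℚ] AlgebraicClosure k) : AlgebraicClosure ℚ →+* AlgebraicClosure k)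
  have hj : ∀ x : k, j (absEmbedding ℚ k x) = (x : ℂ) := fun x => by
    change ιk (absClosureEquiv ℚ k ((absClosureEquiv ℚ k).symm (algebraMap k (AlgebraicClosure k) x))) = (x : ℂ)
    rw [AlgEquiv.apply_symm_apply, AlgHom.commutes]
    rfl
  obtain ⟨c, hc⟩ := exists_absoluteGaloisGroup_smul_eq j (ComplexEmbedding.conjugate j) (Subsingleton.elim _ _)
  refine ⟨j, c, hj, isComplexConjugation_iff.2 ⟨j, Subsingleton.elim _ _, fun y => ?_⟩, fun y => ?_⟩
  · rw [hc, ComplexEmbedding.conjugate_coe_eq]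
  · rw [hc, ComplexEmbedding.conjugate_coe_eq]

/-- **PROPOSITION 4.9, packaged**: for every CM field `K`, CM type `Φ` and number field `k ⊇ E*` in `ℂ` there are data
`(j, c)` as above such that, with `Ψ = Θ⁻¹(Φ)` the CM type on `Γ_ℚ ⧸ Γ_K` read along `j`, Tate's Taniyama element satisfies
`f_Ψ(res τ) = (reflexNormFiniteClassOfGalois [τ])⁻¹` for all `τ ∈ Γ_k` and `N_{k,Φ}(s)_𝐡 · K^× = f_Ψ(res τ⁻¹)` whenever
`[s, k] = [τ]`. [cite: Milne2007FundamentalCM, §4.2 Prop. 4.9] -/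
theorem exists_taniyamaElement_absGaloisRestrict_eq (K : Type) [Field K] [NumberField K] [IsCMField K] (Φ : CMType K)
    (k : IntermediateField ℚ ℂ) [NumberField k] (hk : traceField Φ ≤ k) :
    ∃ (j : AlgebraicClosure ℚ →+* ℂ) (c : absoluteGaloisGroup ℚ),
      (∀ x : k, j (absEmbedding ℚ k x) = (x : ℂ)) ∧ IsComplexConjugation (Rat.castHom ℝ) c ∧
        (∀ y : AlgebraicClosure ℚ, j (c • y) = starRingEnd ℂ (j y)) ∧
          IsCMTypeWith c (embOfCoset K j ⁻¹' Φ.1) ∧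
            (∀ τ : absoluteGaloisGroup k, taniyamaElement K c (embOfCoset K j ⁻¹' Φ.1) (absGaloisRestrict ℚ k τ) =
                (reflexNormFiniteClassOfGalois K Φ k hk (absGaloisAbProj k τ))⁻¹) ∧
              ∀ (τ : absoluteGaloisGroup k) (s : ideleGroup k), absGaloisAbProj k τ = ideleArtinMap k s →
                (QuotientGroup.mk (IdeleAction.finitePart K (reflexNormIdele K Φ k s)) :
                    (FiniteAdeleRing (𝓞 K) K)ˣ ⧸ (FiniteAdeleRing.unitEmbedding (𝓞 K) K).range) =
                  taniyamaElement K c (embOfCoset K j ⁻¹' Φ.1) (absGaloisRestrict ℚ k τ⁻¹) := by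
  obtain ⟨j, c, hj, hc, hjc⟩ := exists_embedding_isComplexConjugation k
  exact ⟨j, c, hj, hc, hjc, isCMTypeWith_preimage_cmType K hc hjc Φ,
    fun τ => taniyamaElement_absGaloisRestrict K Φ k hj hc hjc hk τ,
    fun τ s hs => mk_finitePart_reflexNormIdele_eq_taniyamaElement K Φ k hj hc hjc hk hs⟩

end Existence

end Literature.NumberTheory.ComplexMultiplication

end
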